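import Literature.MathematicalPhysics.QuantumFieldTheory.Chatterjee2019LargeN.WilsonLoopFactorization
import Literature.MathematicalPhysics.QuantumFieldTheory.Chatterjee2019LargeN.MasterLoopUniqueness
import Literature.MathematicalPhysics.QuantumFieldTheory.Chatterjee2019LargeN.SymmetrizedLimitEquation
import Mathlib.Analysis.Normed.Group.FunctionSeries
import HarnessLib

/-!
# Chatterjee 2019, Proposition 4.1 ⇐ Theorems 3.1 + 8.1: the recursion for the coefficients `a_k(s)` by comparison of power series

S. Chatterjee, *Rigorous solution of strongly coupled `SO(N)` lattice gauge theory in the large `N` limit*,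
Comm. Math. Phys. **366** (2019) 203–268 (arXiv:1502.07719).  **§4, proof sketch / Proposition 4.1**: «plugging the
power series `f(s) = Σ_k a_k(s) βᵏ` into the [limiting master loop] equation and equating the coefficients of `βᵏ` on
both sides gives, for `k ≥ 1`, `a_k(s) = (1/m) Σ [splitting terms with a_k] + (1/m) Σ [deformation terms with a_{k−1}]`
(4.2)».  In print the recursion is derived for the hypothetical coefficients `a_k` and then shown (§§10–12, 16) to be
satisfied by the trajectory sums of Corollary 3.5; here we run the argument in the proved direction: GIVEN Theorem 3.1
(`GaugeStringDuality`, whence Corollary 3.5: `lim ⟨W_{l₁}⋯W_{lₙ}⟩/Nⁿ = Σ_k a_k(s) βᵏ` with `a_k(s) = Σ_{X ∈ 𝒳_k(s)} v(X)`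
— `RealAnalyticity.realAnalyticity_of_gaugeStringDuality`) and Theorem 8.1 (`UnsymmetrizedMasterLoopEquation`, whence
Theorem 9.1, the limiting equation — `MasterLoopLimit.thooftMasterLoopEquation_of_unsymmetrized`), the function
`β ↦ m·Σ_k a_k(s)βᵏ − Σ_{splits} Σ_k a_k(s')βᵏ − β Σ_{deformations} Σ_k a_k(s')βᵏ` vanishes identically on
`|β| ≤ β₀`, and is itself an absolutely convergent power series `Σ_k c_k βᵏ` (Lemma 10.1 =
`CoeffCatalanBound.coeffA_mul_pow_summable_abs` for the absolute convergence of every series involved), so all `c_k = 0`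
by the identity theorem for power series — which is (4.2) for `k ≥ 1`.

Main results:
* `CoeffRecursionProof.eq_zero_of_tsum_eq_zero` — identity theorem: if `Σ_k |c_k| rᵏ < ∞` (`r > 0`) and
  `Σ_k c_k βᵏ = 0` for all `0 < β ≤ r`, then every `c_k = 0` (continuity of the shifted series at `0`, induction on `k`).
* `CoeffRecursionProof.splitTermAt_tsum`, `deformTermAt_tsum` — the finite signed sums of Theorem 8.1 commute with
  absolutely convergent series.
* ★ `coeffA_recursion_of_gaugeStringDuality_of_unsymmetrized : GaugeStringDuality d → UnsymmetrizedMasterLoopEquation d →`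
  (the second conjunct of the named fact `CoeffRecursion`): for every genuine `(l, rest)`, every marked location `x₀` of
  `l` (`e = l_{x₀}`, `m = m(e) ≥ 1`) and every `k ≥ 1`,
  `a_k(l, rest) = (1/m)·splitTermAt(a_k ∘ prune) + (1/m)·deformTermAt(a_{k−1} ∘ prune)`.
* (v1.1) ★ `coeffRecursion_of_gaugeStringDuality_of_unsymmetrized : GaugeStringDuality d →
  UnsymmetrizedMasterLoopEquation d → CoeffRecursion d` (with Lemma 11.3 = `coeffA_zero_of_ne_nil` for the first conjunct).

## WHAT THIS IS NOT
Theorems 3.1 and 8.1 remain named facts (hypotheses here).  The first conjunct of `CoeffRecursion` (`a₀(s) = 0` for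
non-null `s`, Lemma 11.3) is the hypothesis-free `LoopOperations.coeffA_zero_of_ne_nil`; the conjunction is
`coeffRecursion_of_gaugeStringDuality_of_unsymmetrized : GaugeStringDuality d → UnsymmetrizedMasterLoopEquation d →
CoeffRecursion d` (v1.1, last declaration).  Nothing here bears on four-dimensional Yang–Mills or a mass gap.
-/

noncomputable section

open Filter Topology Finset
open scoped BigOperators
open Literature.Probability.LatticeModels Literature.MathematicalPhysics.QuantumLattice

namespace Literature.MathematicalPhysics.QuantumFieldTheory.Chatterjee2019LargeN

variable {d : ℕ}

namespace CoeffRecursionProof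

/-! ### An identity theorem for absolutely convergent real power series -/

/-- Shifting an absolutely convergent power series keeps it absolutely convergent on the same disc. [folklore] -/
private theorem summable_shift {c : ℕ → ℝ} {r : ℝ} (hr : 0 < r) (hs : Summable fun k => |c k| * r ^ k) (m : ℕ) :
    Summable fun k => |c (k + m)| * r ^ k := by
  have h := (summable_nat_add_iff m).2 hs
  have he : (fun k => |c (k + m)| * r ^ k) = fun k => (|c (k + m)| * r ^ (k + m)) * (r ^ m)⁻¹ := by
    funext k
    rw [pow_add, mul_assoc, mul_assoc, mul_inv_cancel₀ (pow_ne_zero m hr.ne'), mul_one]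
  rw [he]
  exact h.mul_right _

/-- Termwise domination of the shifted series on `|β| ≤ r`. [folklore] -/
private theorem abs_term_le {c : ℕ → ℝ} {r β : ℝ} (hβ : |β| ≤ r) (m k : ℕ) :
    ‖c (k + m) * β ^ k‖ ≤ |c (k + m)| * r ^ k := by
  rw [Real.norm_eq_abs, abs_mul, abs_pow]
  exact mul_le_mul_of_nonneg_left (pow_le_pow_left₀ (abs_nonneg β) hβ k) (abs_nonneg _)

/-- The shifted series converges on `|β| ≤ r`. [folklore] -/
private theorem summable_sh_term {c : ℕ → ℝ} {r : ℝ} (hr : 0 < r) (hs : Summable fun k => |c k| * r ^ k) (m : ℕ) {β : ℝ}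
    (hβ : |β| ≤ r) : Summable fun k => c (k + m) * β ^ k :=
  Summable.of_norm_bounded (summable_shift hr hs m) fun k => abs_term_le hβ m k

/-- The shifted series is continuous on `[-r, r]` (Weierstrass M-test). [folklore] -/
private theorem continuousOn_sh {c : ℕ → ℝ} {r : ℝ} (hr : 0 < r) (hs : Summable fun k => |c k| * r ^ k) (m : ℕ) :
    ContinuousOn (fun β : ℝ => ∑' k, c (k + m) * β ^ k) (Set.Icc (-r) r) := by
  refine continuousOn_tsum (u := fun k => |c (k + m)| * r ^ k)
    (fun k => (continuous_const.mul (continuous_pow k)).continuousOn) (summable_shift hr hs m) fun k β hβ => ?_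
  exact abs_term_le (abs_le.2 ⟨hβ.1, hβ.2⟩) m k

/-- At `β = 0` the shifted series is its constant term. [folklore] -/
private theorem sh_zero (c : ℕ → ℝ) (m : ℕ) : ∑' k, c (k + m) * (0 : ℝ) ^ k = c m := by
  rw [tsum_eq_single 0 fun k hk => by rw [zero_pow hk, mul_zero]]
  simp

/-- `Σ_k c_{k+m} βᵏ = c_m + β Σ_k c_{k+m+1} βᵏ`. [folklore] -/
private theorem sh_succ {c : ℕ → ℝ} {r : ℝ} (hr : 0 < r) (hs : Summable fun k => |c k| * r ^ k) (m : ℕ) {β : ℝ}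
    (hβ : |β| ≤ r) : ∑' k, c (k + m) * β ^ k = c m + β * ∑' k, c (k + (m + 1)) * β ^ k := by
  rw [(summable_sh_term hr hs m hβ).tsum_eq_zero_add]
  simp only [zero_add, pow_zero, mul_one]
  congr 1
  rw [← tsum_mul_left]
  refine tsum_congr fun k => ?_
  rw [pow_succ, show k + 1 + m = k + (m + 1) by omega]
  ring

/-- **Identity theorem** for absolutely convergent real power series: if `Σ_k |c_k| rᵏ < ∞` and `Σ_k c_k βᵏ = 0` for all
`0 < β ≤ r`, then all `c_k = 0` — the principle behind «equating the coefficients of `βᵏ` on both sides» in §4.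
[cite: Chatterjee2019LargeN, §4 (proof sketch of Proposition 4.1: «equating the coefficients of βᵏ on both sides»)] -/
theorem eq_zero_of_tsum_eq_zero {c : ℕ → ℝ} {r : ℝ} (hr : 0 < r) (hs : Summable fun k => |c k| * r ^ k)
    (h0 : ∀ β : ℝ, 0 < β → β ≤ r → ∑' k, c k * β ^ k = 0) (k : ℕ) : c k = 0 := by
  -- from the vanishing of the `m`-th shifted series on `(0, r]` to `c_m = 0`
  have step : ∀ m, (∀ β : ℝ, 0 < β → β ≤ r → ∑' k, c (k + m) * β ^ k = 0) → c m = 0 := by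
    intro m hm
    have hseq : Tendsto (fun n : ℕ => r / ((n : ℝ) + 1)) atTop (𝓝 0) := by
      have h := (tendsto_const_div_atTop_nhds_zero_nat r).comp (tendsto_add_atTop_nat 1)
      refine h.congr fun n => ?_
      simp only [Function.comp, Nat.cast_add, Nat.cast_one]
    have hmem : ∀ n : ℕ, r / ((n : ℝ) + 1) ∈ Set.Icc (-r) r := fun n => by
      have h1 : 0 ≤ r / ((n : ℝ) + 1) := by positivity
      have h2 : r / ((n : ℝ) + 1) ≤ r := div_le_self hr.le (by linarith [n.cast_nonneg (α := ℝ)])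
      exact ⟨by linarith, h2⟩
    have hlim : Tendsto (fun n : ℕ => ∑' k, c (k + m) * (r / ((n : ℝ) + 1)) ^ k) atTop
        (𝓝 (∑' k, c (k + m) * (0 : ℝ) ^ k)) :=
      ((continuousOn_sh hr hs m) 0 ⟨by linarith, hr.le⟩).tendsto.comp
        (tendsto_nhdsWithin_iff.2 ⟨hseq, Eventually.of_forall hmem⟩)
    have hzero : (fun n : ℕ => ∑' k, c (k + m) * (r / ((n : ℝ) + 1)) ^ k) = fun _ => 0 := funext fun n =>
      hm _ (by positivity) (div_le_self hr.le (by linarith [n.cast_nonneg (α := ℝ)]))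
    rw [hzero] at hlim
    have h := tendsto_nhds_unique hlim tendsto_const_nhds
    rwa [sh_zero] at h
  have hP : ∀ m, (∀ β : ℝ, 0 < β → β ≤ r → ∑' k, c (k + m) * β ^ k = 0) ∧ c m = 0 := by
    intro m
    induction m with
    | zero =>
      have h : ∀ β : ℝ, 0 < β → β ≤ r → ∑' k, c (k + 0) * β ^ k = 0 := fun β hβ hβr => by
        simpa using h0 β hβ hβr
      exact ⟨h, step 0 h⟩
    | succ m ih =>
      have h : ∀ β : ℝ, 0 < β → β ≤ r → ∑' k, c (k + (m + 1)) * β ^ k = 0 := fun β hβ hβr => by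
        have h1 := sh_succ hr hs m (abs_le.2 ⟨by linarith, hβr⟩)
        rw [ih.1 β hβ hβr, ih.2, zero_add] at h1
        exact (mul_eq_zero.1 h1.symm).resolve_left hβ.ne'
      exact ⟨h, step _ h⟩
  exact (hP k).2

/-! ### The signed sums of Theorem 8.1 commute with convergent series -/

/-- The splitting term of a convergent series of evaluations is the series of the splitting terms.
[cite: Chatterjee2019LargeN, §4 («equating the coefficients of βᵏ on both sides»)] -/
theorem splitTermAt_tsum {f : ℕ → LoopSeq d → ℝ} {l : Word d} {rest : LoopSeq d} {e : DEdge d}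
    (h₁ : ∀ xy ∈ Word.invPairs l e, Summable fun k => f k (Word.negSplit₁ l xy.1 xy.2 :: Word.negSplit₂ l xy.1 xy.2 :: rest))
    (h₂ : ∀ xy ∈ Word.samePairs l e, Summable fun k => f k (Word.posSplit₁ l xy.1 xy.2 :: Word.posSplit₂ l xy.1 xy.2 :: rest)) :
    splitTermAt (fun u => ∑' k, f k u) l rest e = ∑' k, splitTermAt (f k) l rest e := by
  simp only [splitTermAt]
  rw [(summable_sum h₁).tsum_sub (summable_sum h₂), Summable.tsum_finsetSum h₁, Summable.tsum_finsetSum h₂]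

/-- The deformation term of a convergent series of evaluations is the series of the deformation terms.
[cite: Chatterjee2019LargeN, §4 («equating the coefficients of βᵏ on both sides»)] -/
theorem deformTermAt_tsum {f : ℕ → LoopSeq d → ℝ} {l : Word d} {rest : LoopSeq d} {e : DEdge d}
    (h₁ : ∀ p ∈ plaquettesAt e, ∀ x ∈ Word.locs l e, Summable fun k => f k (Word.negDeform l x p :: rest))
    (h₂ : ∀ p ∈ plaquettesAt e, ∀ x ∈ Word.locs l e, Summable fun k => f k (Word.posDeform l x p :: rest)) :
    deformTermAt (fun u => ∑' k, f k u) l rest e = ∑' k, deformTermAt (f k) l rest e := by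
  simp only [deformTermAt]
  have h₁' : ∀ p ∈ plaquettesAt e, Summable fun k => ∑ x ∈ Word.locs l e, f k (Word.negDeform l x p :: rest) :=
    fun p hp => summable_sum (h₁ p hp)
  have h₂' : ∀ p ∈ plaquettesAt e, Summable fun k => ∑ x ∈ Word.locs l e, f k (Word.posDeform l x p :: rest) :=
    fun p hp => summable_sum (h₂ p hp)
  rw [(summable_sum h₁').tsum_sub (summable_sum h₂'), Summable.tsum_finsetSum h₁', Summable.tsum_finsetSum h₂',
    Finset.sum_congr rfl fun p hp => Summable.tsum_finsetSum (h₁ p hp),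
    Finset.sum_congr rfl fun p hp => Summable.tsum_finsetSum (h₂ p hp)]

/-- Members of `prune (L ++ rest)` are genuine when `rest` is and the words of `L` are loops. [folklore] -/
private theorem isLoopSeq_prune_append {L rest : LoopSeq d} (hrest : IsLoopSeq rest) (hL : ∀ w ∈ L, IsLoop w) :
    IsLoopSeq (LoopSeq.prune (L ++ rest)) :=
  LoopSeq.isLoopSeq_prune fun w hw => by
    rcases List.mem_append.mp hw with h | h
    · exact hL w h
    · exact (hrest w h).1

end CoeffRecursionProof

open CoeffRecursionProof

/-- ★ **Proposition 4.1 (the recursion (4.2) for `a_k(s)`, `k ≥ 1`) ⇐ Theorems 3.1 + 8.1, PROVED** — the second conjunct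
of the named fact `CoeffRecursion`: «`a_k(s) = (1/m) Σ_{x∈A₁,y∈B₁ or x∈B₁,y∈A₁} a_k(×¹_{x,y}l₁, ×²_{x,y}l₁, l₂, …)
− (1/m) Σ_{x≠y both in A₁ or both in B₁} a_k(×¹, ×², l₂, …) + (1/m) Σ_{p∈𝒫⁺(e)} Σ_{x∈C₁} (a_{k−1}(l₁ ⊖ₓ p, l₂, …)
− a_{k−1}(l₁ ⊕ₓ p, l₂, …))`» for every genuine `(l₁, l₂, …)`, every location `x₀` of `l₁` (`e = (l₁)_{x₀}`,
`m = m(e)`) and `k ≥ 1`, with `a_k(s) = Σ_{X∈𝒳_k(s)} v(X)` (`coeffA`), all reduced sequences read through `prune`.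
Proof: §4's «plug the power series into the limiting master loop equation (Theorem 9.1 ⇐ 8.1; the series is the limit by
Corollary 3.5 ⇐ 3.1) and equate coefficients» — made honest by absolute convergence (Lemma 10.1) and the identity
theorem `eq_zero_of_tsum_eq_zero`. [cite: Chatterjee2019LargeN, Proposition 4.1 / eq. (4.2), §4 (proof sketch), Corollary 3.5, Theorem 9.1] -/
theorem coeffA_recursion_of_gaugeStringDuality_of_unsymmetrized (hG : GaugeStringDuality d)
    (hU : UnsymmetrizedMasterLoopEquation d) : 2 ≤ d →
    ∀ (l : Word d) (rest : LoopSeq d), IsLoopSeq (l :: rest) → ∀ (x₀ : Fin l.length) (k : ℕ), 1 ≤ k →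
      coeffA (l :: rest) k =
        (1 / (Word.occ l (l.get x₀) : ℝ)) *
            splitTermAt (fun s' => coeffA (LoopSeq.prune s') k) l rest (l.get x₀)
          + (1 / (Word.occ l (l.get x₀) : ℝ)) *
            deformTermAt (fun s' => coeffA (LoopSeq.prune s') (k - 1)) l rest (l.get x₀) := by
  intro hd l rest hs x₀
  obtain ⟨β₀, hβ₀, H0⟩ := realAnalyticity_of_gaugeStringDuality hG hd
  obtain ⟨β₁, hβ₁, H1⟩ := coeffA_mul_pow_summable_abs (d := d)
  obtain ⟨Λ, hΛ⟩ := MasterLoopUniquenessProof.exists_isExhaustion d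
  have hT := thooftMasterLoopEquation_of_unsymmetrized hU hd Λ hΛ
  set e := l.get x₀ with he
  set r := min β₀ β₁ with hr
  have hrpos : 0 < r := lt_min hβ₀ hβ₁
  have hl : IsLoop l := (hs l (by simp)).1
  have hrest : IsLoopSeq rest := fun w hw => hs w (List.mem_cons_of_mem _ hw)
  -- genuineness of everything produced at the marked edge
  have gSplitNeg : ∀ xy ∈ Word.invPairs l e,
      IsLoopSeq (LoopSeq.prune (Word.negSplit₁ l xy.1 xy.2 :: Word.negSplit₂ l xy.1 xy.2 :: rest)) := fun xy hxy =>
    isLoopSeq_prune_append (L := [_, _]) hrest (by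
      have h := Word.get_eq_of_mem_invPairs hxy
      intro w hw; simp only [List.mem_cons, List.not_mem_nil, or_false] at hw
      rcases hw with rfl | rfl
      exacts [Word.isLoop_negSplit₁ hl.1 h, Word.isLoop_negSplit₂ hl.1 h])
  have gSplitPos : ∀ xy ∈ Word.samePairs l e,
      IsLoopSeq (LoopSeq.prune (Word.posSplit₁ l xy.1 xy.2 :: Word.posSplit₂ l xy.1 xy.2 :: rest)) := fun xy hxy =>
    isLoopSeq_prune_append (L := [_, _]) hrest (by
      obtain ⟨hne, h⟩ := Word.get_eq_of_mem_samePairs hxy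
      intro w hw; simp only [List.mem_cons, List.not_mem_nil, or_false] at hw
      rcases hw with rfl | rfl
      exacts [Word.isLoop_posSplit₁ hl.1 hne h, Word.isLoop_posSplit₂ hl.1 hne h])
  have gDefNeg : ∀ p ∈ plaquettesAt e, ∀ x ∈ Word.locs l e, IsLoopSeq (LoopSeq.prune (Word.negDeform l x p :: rest)) :=
    fun p hp x hx => isLoopSeq_prune_append (L := [_]) hrest (by
      intro w hw; simp only [List.mem_cons, List.not_mem_nil, or_false] at hw
      subst hw
      exact Word.isLoop_negDeform hl.1 x (by rwa [Word.plaquettesAt_eq_of_mem_locs hx]))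
  have gDefPos : ∀ p ∈ plaquettesAt e, ∀ x ∈ Word.locs l e, IsLoopSeq (LoopSeq.prune (Word.posDeform l x p :: rest)) :=
    fun p hp x hx => isLoopSeq_prune_append (L := [_]) hrest (by
      intro w hw; simp only [List.mem_cons, List.not_mem_nil, or_false] at hw
      subst hw
      exact Word.isLoop_posDeform hl.1 x (by rwa [Word.plaquettesAt_eq_of_mem_locs hx]))
  -- the coefficients of the three power series
  set A : ℕ → ℝ := fun k => coeffA (l :: rest) k with hA
  set S : ℕ → ℝ := fun k => splitTermAt (fun s' => coeffA (LoopSeq.prune s') k) l rest e with hS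
  set D : ℕ → ℝ := fun k => deformTermAt (fun s' => coeffA (LoopSeq.prune s') k) l rest e with hD
  set m : ℝ := (Word.occ l e : ℝ) with hm
  have hmpos : 0 < m := by rw [hm]; exact_mod_cast Word.occ_get_pos l x₀
  -- the combined coefficients
  set c : ℕ → ℝ := fun k => m * A k - S k - (if 1 ≤ k then D (k - 1) else 0) with hc
  -- absolute summability of every series involved at radius `r`
  have habsr : |r| ≤ β₁ := by rw [abs_of_pos hrpos]; exact min_le_right _ _
  have sumG : ∀ t : LoopSeq d, IsLoopSeq t → ∀ β : ℝ, |β| ≤ r → Summable fun k => |coeffA t k * β ^ k| :=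
    fun t ht β hβ => H1 β (hβ.trans (min_le_right _ _)) t ht
  have sumG' : ∀ t : LoopSeq d, IsLoopSeq t → ∀ β : ℝ, |β| ≤ r → Summable fun k => coeffA t k * β ^ k :=
    fun t ht β hβ => (sumG t ht β hβ).of_abs
  have sumA : Summable fun k => |A k| * r ^ k := by
    have h := sumG _ hs r (by rw [abs_of_pos hrpos])
    refine h.congr fun k => ?_
    rw [abs_mul, abs_pow, abs_of_pos hrpos]
  have sumS : Summable fun k => |S k| * r ^ k := by
    have hb : ∀ k, |S k| * r ^ k ≤
        (∑ xy ∈ Word.invPairs l e, |coeffA (LoopSeq.prune (Word.negSplit₁ l xy.1 xy.2 :: Word.negSplit₂ l xy.1 xy.2 :: rest)) k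
            * r ^ k|)
        + ∑ xy ∈ Word.samePairs l e, |coeffA (LoopSeq.prune (Word.posSplit₁ l xy.1 xy.2 :: Word.posSplit₂ l xy.1 xy.2 :: rest)) k
            * r ^ k| := fun k => by
      have hrk : 0 ≤ r ^ k := pow_nonneg hrpos.le k
      rw [hS]
      simp only [splitTermAt]
      calc |(∑ xy ∈ Word.invPairs l e, coeffA (LoopSeq.prune (Word.negSplit₁ l xy.1 xy.2 :: Word.negSplit₂ l xy.1 xy.2 :: rest)) k)
              - ∑ xy ∈ Word.samePairs l e, coeffA (LoopSeq.prune (Word.posSplit₁ l xy.1 xy.2 :: Word.posSplit₂ l xy.1 xy.2 :: rest)) k|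
              * r ^ k
          ≤ ((∑ xy ∈ Word.invPairs l e, |coeffA (LoopSeq.prune (Word.negSplit₁ l xy.1 xy.2 :: Word.negSplit₂ l xy.1 xy.2 :: rest)) k|)
              + ∑ xy ∈ Word.samePairs l e, |coeffA (LoopSeq.prune (Word.posSplit₁ l xy.1 xy.2 :: Word.posSplit₂ l xy.1 xy.2 :: rest)) k|)
              * r ^ k := by
            refine mul_le_mul_of_nonneg_right ((abs_sub _ _).trans (add_le_add (abs_sum_le_sum_abs _ _)
              (abs_sum_le_sum_abs _ _))) hrk
        _ = _ := by
            rw [add_mul, Finset.sum_mul, Finset.sum_mul]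
            congr 1 <;> refine Finset.sum_congr rfl fun xy _ => ?_ <;>
              rw [abs_mul, abs_pow, abs_of_pos hrpos]
    refine Summable.of_nonneg_of_le (fun k => mul_nonneg (abs_nonneg _) (pow_nonneg hrpos.le k)) hb ?_
    exact (summable_sum fun xy hxy => sumG _ (gSplitNeg xy hxy) r (by rw [abs_of_pos hrpos])).add
      (summable_sum fun xy hxy => sumG _ (gSplitPos xy hxy) r (by rw [abs_of_pos hrpos]))
  have sumD : Summable fun k => |D k| * r ^ k := by
    have hb : ∀ k, |D k| * r ^ k ≤
        (∑ p ∈ plaquettesAt e, ∑ x ∈ Word.locs l e, |coeffA (LoopSeq.prune (Word.negDeform l x p :: rest)) k * r ^ k|)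
        + ∑ p ∈ plaquettesAt e, ∑ x ∈ Word.locs l e, |coeffA (LoopSeq.prune (Word.posDeform l x p :: rest)) k * r ^ k| :=
      fun k => by
      have hrk : 0 ≤ r ^ k := pow_nonneg hrpos.le k
      rw [hD]
      simp only [deformTermAt]
      calc |(∑ p ∈ plaquettesAt e, ∑ x ∈ Word.locs l e, coeffA (LoopSeq.prune (Word.negDeform l x p :: rest)) k)
              - ∑ p ∈ plaquettesAt e, ∑ x ∈ Word.locs l e, coeffA (LoopSeq.prune (Word.posDeform l x p :: rest)) k| * r ^ k
          ≤ ((∑ p ∈ plaquettesAt e, ∑ x ∈ Word.locs l e, |coeffA (LoopSeq.prune (Word.negDeform l x p :: rest)) k|)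
              + ∑ p ∈ plaquettesAt e, ∑ x ∈ Word.locs l e, |coeffA (LoopSeq.prune (Word.posDeform l x p :: rest)) k|)
              * r ^ k := by
            refine mul_le_mul_of_nonneg_right ((abs_sub _ _).trans (add_le_add ?_ ?_)) hrk
            · exact (abs_sum_le_sum_abs _ _).trans (Finset.sum_le_sum fun p _ => abs_sum_le_sum_abs _ _)
            · exact (abs_sum_le_sum_abs _ _).trans (Finset.sum_le_sum fun p _ => abs_sum_le_sum_abs _ _)
        _ = _ := by
            rw [add_mul, Finset.sum_mul, Finset.sum_mul]
            congr 1 <;> refine Finset.sum_congr rfl fun p _ => ?_ <;> rw [Finset.sum_mul] <;>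
              refine Finset.sum_congr rfl fun x _ => ?_ <;> rw [abs_mul, abs_pow, abs_of_pos hrpos]
    refine Summable.of_nonneg_of_le (fun k => mul_nonneg (abs_nonneg _) (pow_nonneg hrpos.le k)) hb ?_
    exact (summable_sum fun p hp => summable_sum fun x hx => sumG _ (gDefNeg p hp x hx) r (by rw [abs_of_pos hrpos])).add
      (summable_sum fun p hp => summable_sum fun x hx => sumG _ (gDefPos p hp x hx) r (by rw [abs_of_pos hrpos]))
  have sumI : Summable fun k => |(if 1 ≤ k then D (k - 1) else 0)| * r ^ k := by
    refine (summable_nat_add_iff 1).1 ?_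
    have he' : (fun k => |(if 1 ≤ k + 1 then D (k + 1 - 1) else 0)| * r ^ (k + 1)) = fun k => |D k| * r ^ k * r := by
      funext k
      rw [if_pos (by omega), Nat.add_sub_cancel, pow_succ, mul_assoc]
    rw [he']
    exact sumD.mul_right r
  have sumc : Summable fun k => |c k| * r ^ k := by
    refine Summable.of_nonneg_of_le (fun k => mul_nonneg (abs_nonneg _) (pow_nonneg hrpos.le k)) (fun k => ?_)
      (((sumA.mul_left m).add sumS).add sumI)
    have hrk : 0 ≤ r ^ k := pow_nonneg hrpos.le k
    calc |c k| * r ^ k ≤ (m * |A k| + |S k| + |(if 1 ≤ k then D (k - 1) else 0)|) * r ^ k := by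
          refine mul_le_mul_of_nonneg_right ?_ hrk
          calc |c k| = |m * A k - S k - (if 1 ≤ k then D (k - 1) else 0)| := rfl
            _ ≤ |m * A k - S k| + |(if 1 ≤ k then D (k - 1) else 0)| := abs_sub _ _
            _ ≤ |m * A k| + |S k| + |(if 1 ≤ k then D (k - 1) else 0)| := by
                have := abs_sub (m * A k) (S k); linarith
            _ = m * |A k| + |S k| + |(if 1 ≤ k then D (k - 1) else 0)| := by rw [abs_mul, abs_of_pos hmpos]
      _ = m * (|A k| * r ^ k) + |S k| * r ^ k + |(if 1 ≤ k then D (k - 1) else 0)| * r ^ k := by ring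
  -- termwise summability at `|β| ≤ r`
  have dom : ∀ {g : ℕ → ℝ}, Summable (fun k => |g k| * r ^ k) → ∀ β : ℝ, |β| ≤ r → Summable fun k => g k * β ^ k :=
    fun hg β hβ => Summable.of_norm_bounded hg fun k => by
      rw [Real.norm_eq_abs, abs_mul, abs_pow]
      exact mul_le_mul_of_nonneg_left (pow_le_pow_left₀ (abs_nonneg β) hβ k) (abs_nonneg _)
  -- the vanishing of `Σ c_k βᵏ` on `(0, r]`: the limiting master loop equation for the series
  have hvanish : ∀ β : ℝ, 0 < β → β ≤ r → ∑' k, c k * β ^ k = 0 := by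
    intro β hβ hβr
    have hβa : |β| ≤ r := by rw [abs_of_pos hβ]; exact hβr
    have hβ0 : |β| ≤ β₀ := hβa.trans (min_le_left _ _)
    -- the series as the 't Hooft limit
    set Φ : LoopSeq d → ℝ := fun t => ∑' k, coeffA t k * β ^ k with hΦ
    have hlim : ∀ t : LoopSeq d, IsLoopSeq t → Tendsto (fun n : ℕ => phi (id n) β (Λ (id n)) t) atTop (𝓝 (Φ t)) := by
      intro t ht
      by_cases htn : t = []
      · subst htn
        have h1 : Φ [] = 1 := Factorization.tsum_coeffA_mul_pow_nil β
        rw [h1]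
        exact tendsto_const_nhds.congr fun n => (phi_nil _ _ _).symm
      · exact (H0 Λ hΛ β hβ0 t ht htn).2
    have hEq := hT β id strictMono_id Φ hlim l rest hs x₀
    -- expand the three terms as power series
    have hS' : splitTermAt (fun s' => Φ (LoopSeq.prune s')) l rest e = ∑' k, S k * β ^ k := by
      have h := splitTermAt_tsum (f := fun k u => coeffA (LoopSeq.prune u) k * β ^ k) (l := l) (rest := rest) (e := e)
        (fun xy hxy => sumG' _ (gSplitNeg xy hxy) β hβa) (fun xy hxy => sumG' _ (gSplitPos xy hxy) β hβa)
      rw [show (fun s' => Φ (LoopSeq.prune s')) = fun u => ∑' k, coeffA (LoopSeq.prune u) k * β ^ k from rfl, h]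
      refine tsum_congr fun k => ?_
      rw [hS]
      simp only
      rw [mul_comm (splitTermAt _ _ _ _) (β ^ k), ← splitTermAt_mul]
      exact congrArg (fun F => splitTermAt F l rest e) (funext fun u => mul_comm _ _)
    have hD' : deformTermAt (fun s' => Φ (LoopSeq.prune s')) l rest e = ∑' k, D k * β ^ k := by
      have h := deformTermAt_tsum (f := fun k u => coeffA (LoopSeq.prune u) k * β ^ k) (l := l) (rest := rest) (e := e)
        (fun p hp x hx => sumG' _ (gDefNeg p hp x hx) β hβa) (fun p hp x hx => sumG' _ (gDefPos p hp x hx) β hβa)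
      rw [show (fun s' => Φ (LoopSeq.prune s')) = fun u => ∑' k, coeffA (LoopSeq.prune u) k * β ^ k from rfl, h]
      refine tsum_congr fun k => ?_
      rw [hD]
      simp only
      rw [mul_comm (deformTermAt _ _ _ _) (β ^ k), ← deformTermAt_mul]
      exact congrArg (fun F => deformTermAt F l rest e) (funext fun u => mul_comm _ _)
    have hI' : β * ∑' k, D k * β ^ k = ∑' k, (if 1 ≤ k then D (k - 1) else 0) * β ^ k := by
      rw [(dom sumI β hβa).tsum_eq_zero_add]
      simp only [Nat.le_zero, Nat.one_ne_zero, if_false, zero_mul, zero_add, le_add_iff_nonneg_left, Nat.zero_le,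
        if_true, Nat.add_sub_cancel]
      rw [← tsum_mul_left]
      refine tsum_congr fun k => ?_
      rw [pow_succ]
      ring
    have hsumA := dom sumA β hβa
    have hsumS := dom sumS β hβa
    have hsumI := dom sumI β hβa
    have hsplit : (fun k => c k * β ^ k) = fun k => (m * A k * β ^ k - S k * β ^ k) - (if 1 ≤ k then D (k - 1) else 0) * β ^ k := by
      funext k; rw [hc]; ring
    rw [hsplit, (( hsumA.mul_left m |>.congr fun k => by ring).sub hsumS).tsum_sub hsumI,
      (hsumA.mul_left m |>.congr fun k => by ring).tsum_sub hsumS]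
    rw [show (∑' k, m * A k * β ^ k) = m * Φ (l :: rest) by
      rw [hΦ]; simp only; rw [← tsum_mul_left]; exact tsum_congr fun k => by rw [hA]; ring]
    rw [← hS', ← hI', ← hD', he, hEq]
    ring
  -- identity theorem, then solve for `a_k`
  intro k hk
  have hck := eq_zero_of_tsum_eq_zero hrpos sumc hvanish k
  simp only [hc, if_pos hk] at hck
  have hmne : m ≠ 0 := hmpos.ne'
  have hAk : A k = (1 / m) * S k + (1 / m) * D (k - 1) := by
    field_simp
    linarith
  simpa [hA, hS, hD, hm, he] using hAk

/-- ★ **Proposition 4.1 as rendered by the named fact `CoeffRecursion`, PROVED from Theorems 3.1 + 8.1**: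
`CoeffRecursion d` — (i) `a₀(s) = 0` for every genuine non-null `s` (Lemma 11.3, hypothesis-free:
`LoopOperations.coeffA_zero_of_ne_nil`) and (ii) the recursion (4.2) for `k ≥ 1`
(`coeffA_recursion_of_gaugeStringDuality_of_unsymmetrized`).  Net effect on the fact graph: `CoeffRecursion ⇐
{GaugeStringDuality, UnsymmetrizedMasterLoopEquation}`. [cite: Chatterjee2019LargeN, Proposition 4.1, eq. (4.2), Lemma 11.3] -/
theorem coeffRecursion_of_gaugeStringDuality_of_unsymmetrized (hG : GaugeStringDuality d)
    (hU : UnsymmetrizedMasterLoopEquation d) : CoeffRecursion d := fun hd =>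
  ⟨fun _ hs hne => coeffA_zero_of_ne_nil hs hne, coeffA_recursion_of_gaugeStringDuality_of_unsymmetrized hG hU hd⟩

end Literature.MathematicalPhysics.QuantumFieldTheory.Chatterjee2019LargeN

end
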